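import Mathlib
import Summits.Ventures.PercRepro2.SwOutShadowMultiRootIneq
import Summits.Ventures.PercRepro2.SwOutCubeWeak

/-!
# THE FROZEN BASE, I: design 19's blocks as a Lean structure — `FrozenBaseG` — and the red edge
set of `h` increasing along the cube (blind cell PercRepro2, night-4 g38, 2026-08-29;
proofs/NIGHT4-G38.md §2; the blueprint NIGHT4-G36.md §6 (a′))

`FrozenBaseG` generalises `FrozenBaseE` (SwOutFrozenBaseDefs, the special case in which every
root–root edge is a coordinate and the frozen part has no edge to the outside of `H`) to exactly
the blocks of design 19 of mining/night-4/g36/shadow19.py (FROZEN UNITS: the block of a side point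
is the cube over its MOVABLE units): g35's `DecoBaseE` with a FROZEN part `Fz` inside the hull
region `H` — the blue arms of the block in their `false` state, attached to the roots in BLUE,
never flipped — and the root–root edges split into the COORDINATES `RR` (red at the base) and the
FROZEN root–root edges (blue at every cube point); only the movable arms need blue edges to the
outside of `H`; no edge joins a movable arm to `Fz`; the movable units are pairwise disjoint with
no edge between two of them; NOTHING is assumed about the edges at a decoration vertex (they may
see bystanders, `l`: the impurity of the frontier).  The realisation of a cube point is g35's
`decoRealRR` (the union flip of the units assigned `false`, the coordinates assigned `false`
negated): `Fz` is in no unit, so it is never flipped, and an edge between a movable unit and `Fz`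
toggles with the unit.

This file: the structure, the unit facts, the value of a realisation on every kind of edge, the
injectivity; then at every cube point a red path from a root visits roots and `true` movable arms
only (`red_closed`), so the red cluster of a root and the red edge set of `h` are INCREASING in the
cube point (`redEdges_decoRealRR_mono` — hT of g36's weak cube principle).  The antipode and the
block inequality: SwOutFrozenBaseGAntipode; the hinge: SwOutFrozenBaseGHinge; the row:
SwOutFrozenBaseGRow.  The four parts as one file: HOME/lean-drafts/NIGHT4-G38-FrozenConcat.lean.txt.
-/

namespace Summit.Ventures.PercRepro2

namespace LocRows

open Hull

universe u v

variable {V : Type u} {E : Type v}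

open scoped Classical

variable {ends : E → Sym2 V}

/-! ## §1 The frozen base -/

/-- **The data of a frozen base**: roots `R`, movable arms `A i` with decorations `Z i`, root–root
edges `RR`, a frozen part `Fz` — all inside the hull region `H` except the decorations and `l`.
Edges at a root go to a root, a movable arm (red) or `Fz` (blue); the root–root edges `RR` (the
coordinates) are red, the other root–root edges (frozen) blue; an edge from a movable arm to the
outside of `H` is blue; no edge joins a movable arm to `Fz`; the movable units `A i ∪ Z i` are
pairwise disjoint and no edge joins two of them; every movable arm vertex lies on an edge
(injectivity). -/
structure FrozenBaseG (ends : E → Sym2 V) (ζ : Config E) (R : Set V) (H : Set V) (l : V)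
    {ι : Type*} (A Z : ι → Set V) (RR : Finset E) (Fz : Set V) : Prop where
  root_sub : R ⊆ H
  fz_sub : Fz ⊆ H
  fz_notMem_root : ∀ z ∈ Fz, z ∉ R
  bdry_blue : ∀ i, ∀ e x y, ends e = s(x, y) → x ∈ A i → y ∉ H → ζ e = false
  arm_sub : ∀ i, ∀ x ∈ A i, x ∈ H ∧ x ∉ R ∧ x ∉ Fz
  arm_nonempty : ∀ i, (A i).Nonempty
  arm_edge : ∀ i, ∀ x ∈ A i, ∃ e, x ∈ ends e
  arm_disj : ∀ i j, i ≠ j → ∀ x, x ∈ A i → x ∉ A j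
  arm_cover : ∀ x ∈ H, x ∉ R → x ∉ Fz → ∃ i, x ∈ A i
  root_edges : ∀ e r x, r ∈ R → ends e = s(r, x) → x ∈ R ∨ (∃ i, x ∈ A i) ∨ x ∈ Fz
  loop_root : ∀ e r, r ∈ R → ends e ≠ s(r, r)
  root_arm_red : ∀ e r x, r ∈ R → ends e = s(r, x) → (∃ i, x ∈ A i) → ζ e = true
  root_fz_blue : ∀ e r x, r ∈ R → ends e = s(r, x) → x ∈ Fz → ζ e = false
  rr_sub : ∀ e ∈ RR, ∃ r ∈ R, ∃ r' ∈ R, ends e = s(r, r')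
  rr_red : ∀ e ∈ RR, ζ e = true
  rr_blue : ∀ e r r', r ∈ R → r' ∈ R → ends e = s(r, r') → e ∉ RR → ζ e = false
  no_arm_fz : ∀ e x y, ends e = s(x, y) → (∃ i, x ∈ A i) → y ∉ Fz
  l_notMem : l ∉ H
  deco_notMem : ∀ i, ∀ z ∈ Z i, z ∉ H
  deco_ne_l : ∀ i, l ∉ Z i
  deco_disj : ∀ i j, i ≠ j → ∀ z, z ∈ Z i → z ∉ Z j
  no_cross : ∀ i j, i ≠ j → ∀ e x y, ends e = s(x, y) → x ∈ unitAZ A Z i → y ∈ unitAZ A Z j →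
    False

section Base

variable {ι : Type*} {A Z : ι → Set V} {ζ : Config E} {R H : Set V} {l : V} {RR : Finset E}
  {Fz : Set V} (hb : FrozenBaseG ends ζ R H l A Z RR Fz)
include hb

/-- A root lies in no movable arm. -/
lemma FrozenBaseG.root_notMem_arm {r : V} (hr : r ∈ R) (i : ι) : r ∉ A i :=
  fun h' => (hb.arm_sub i r h').2.1 hr

/-- A decoration vertex lies in no arm. -/
lemma FrozenBaseG.deco_notMem_arm {i j : ι} {z : V} (hz : z ∈ Z i) : z ∉ A j :=
  fun h' => hb.deco_notMem i z hz (hb.arm_sub j z h').1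

/-- A decoration vertex is not frozen. -/
lemma FrozenBaseG.deco_notMem_fz {i : ι} {z : V} (hz : z ∈ Z i) : z ∉ Fz :=
  fun h' => hb.deco_notMem i z hz (hb.fz_sub h')

/-- A frozen vertex lies in no unit. -/
lemma FrozenBaseG.fz_notMem_unit {z : V} (hz : z ∈ Fz) (i : ι) : z ∉ unitAZ A Z i := by
  rintro (h' | h')
  · exact (hb.arm_sub i z h').2.2 hz
  · exact hb.deco_notMem i z h' (hb.fz_sub hz)

/-- A root lies in no unit. -/
lemma FrozenBaseG.root_notMem_unit {r : V} (hr : r ∈ R) (i : ι) : r ∉ unitAZ A Z i := by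
  rintro (h' | h')
  · exact hb.root_notMem_arm hr i h'
  · exact hb.deco_notMem i r h' (hb.root_sub hr)

/-- `l` lies in no unit. -/
lemma FrozenBaseG.l_notMem_unit (i : ι) : l ∉ unitAZ A Z i := by
  rintro (h' | h')
  · exact hb.l_notMem (hb.arm_sub i l h').1
  · exact hb.deco_ne_l i h'

/-- **Units are pairwise disjoint.** -/
lemma FrozenBaseG.unit_disj {i j : ι} (hij : i ≠ j) {x : V} (hx : x ∈ unitAZ A Z i) :
    x ∉ unitAZ A Z j := by
  rintro (h' | h')
  · rcases hx with hx | hx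
    · exact hb.arm_disj i j hij x hx h'
    · exact hb.deco_notMem_arm hx h'
  · rcases hx with hx | hx
    · exact hb.deco_notMem_arm h' hx
    · exact hb.deco_disj i j hij x hx h'

/-- **The two ends of an edge in units lie in the same unit.** -/
lemma FrozenBaseG.unit_eq_of_edge {i j : ι} {e : E} {x y : V} (hxy : ends e = s(x, y))
    (hx : x ∈ unitAZ A Z i) (hy : y ∈ unitAZ A Z j) : i = j := by
  by_contra hij
  exact hb.no_cross i j hij e x y hxy hx hy

/-- An edge with an end in a unit is not a root–root edge. -/
lemma FrozenBaseG.notMem_rr_of_mem_unit {e : E} {x y : V} (hxy : ends e = s(x, y)) {i : ι}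
    (hx : x ∈ unitAZ A Z i) : e ∉ RR := by
  intro he
  obtain ⟨r, hr, r', hr', hrr⟩ := hb.rr_sub e he
  rw [hxy, Sym2.eq_iff] at hrr
  rcases hrr with ⟨rfl, -⟩ | ⟨rfl, -⟩
  · exact hb.root_notMem_unit hr i hx
  · exact hb.root_notMem_unit hr' i hx

/-- An edge with an end that is no root is no root–root edge. -/
lemma FrozenBaseG.notMem_rr_of_notMem_R {e : E} {x y : V} (hxy : ends e = s(x, y))
    (hx : x ∉ R) : e ∉ RR := by
  intro he
  obtain ⟨r, hr, r', hr', hrr⟩ := hb.rr_sub e he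
  rw [hxy, Sym2.eq_iff] at hrr
  rcases hrr with ⟨rfl, -⟩ | ⟨rfl, -⟩
  · exact hx hr
  · exact hx hr'

/-- An edge with an end in the unit `i` touches the units assigned `false` iff `ω i = false`. -/
lemma FrozenBaseG.touches_unitsFalse_iff {ω : Config ι} {i : ι} {e : E} {x y : V}
    (hxy : ends e = s(x, y)) (hx : x ∈ unitAZ A Z i) :
    e ∈ touches ends (armsFalseC (unitAZ A Z) ω) ↔ ω i = false := by
  constructor
  · rintro ⟨z, ⟨j, hj, hz⟩, w, hzw⟩
    rw [hxy, Sym2.eq_iff] at hzw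
    rcases hzw with ⟨h1, _⟩ | ⟨_, h2⟩
    · rw [← h1] at hz
      have hji : j = i := by
        by_contra hne
        exact hb.unit_disj hne hz hx
      rw [← hji]; exact hj
    · rw [← h2] at hz
      have hij : i = j := hb.unit_eq_of_edge hxy hx hz
      rw [hij]; exact hj
  · intro hi
    exact ⟨x, ⟨i, hi, hx⟩, y, hxy⟩

/-- **The value of a realisation on an edge with an end in the unit `i`.** -/
lemma FrozenBaseG.decoRealRR_apply_of_mem {ω : Config (ι ⊕ ↥RR)} {i : ι} {e : E} {x y : V}
    (hxy : ends e = s(x, y)) (hx : x ∈ unitAZ A Z i) :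
    decoRealRR ends A Z RR ζ ω e = (if ω (Sum.inl i) = true then ζ e else !ζ e) := by
  rw [decoRealRR_apply_of_notMem_rr (hb.notMem_rr_of_mem_unit hxy hx)]
  by_cases hi : ω (Sum.inl i) = true
  · rw [flip_apply_of_notMem, if_pos hi]
    rw [hb.touches_unitsFalse_iff hxy hx]; simp [armPart, hi]
  · rw [flip_apply_of_mem, if_neg hi]
    rw [hb.touches_unitsFalse_iff hxy hx]
    simpa [armPart] using hi

/-- An edge at a root with its other end in `A i` is red at a cube point iff `ω (inl i) = true`. -/
lemma FrozenBaseG.decoRealRR_root_edge {ω : Config (ι ⊕ ↥RR)} {i : ι} {e : E} {r x : V}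
    (hr : r ∈ R) (hrx : ends e = s(r, x)) (hx : x ∈ A i) :
    decoRealRR ends A Z RR ζ ω e = true ↔ ω (Sum.inl i) = true := by
  rw [hb.decoRealRR_apply_of_mem (ends_swap hrx) (Or.inl hx), hb.root_arm_red e r x hr hrx ⟨i, hx⟩]
  by_cases hi : ω (Sum.inl i) = true <;> simp [hi]

/-- A root–root edge is red at a cube point iff its coordinate is `true`. -/
lemma FrozenBaseG.decoRealRR_rr_edge {ω : Config (ι ⊕ ↥RR)} {e : E} (he : e ∈ RR) :
    decoRealRR ends A Z RR ζ ω e = true ↔ ω (Sum.inr ⟨e, he⟩) = true := by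
  rw [decoRealRR_apply_rr he, hb.rr_red e he]
  by_cases hi : ω (Sum.inr ⟨e, he⟩) = true <;> simp [hi]

/-- An edge from `A i` to the outside of `H` is red at a cube point iff `ω (inl i) = false`. -/
lemma FrozenBaseG.decoRealRR_out_edge {ω : Config (ι ⊕ ↥RR)} {i : ι} {e : E} {x y : V}
    (hxy : ends e = s(x, y)) (hx : x ∈ A i) (hy : y ∉ H) :
    decoRealRR ends A Z RR ζ ω e = true ↔ ω (Sum.inl i) = false := by
  rw [hb.decoRealRR_apply_of_mem hxy (Or.inl hx), hb.bdry_blue i e x y hxy hx hy]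
  by_cases hi : ω (Sum.inl i) = true <;> simp [hi]

/-- A frozen root–root edge (not a coordinate) is blue at every cube point. -/
lemma FrozenBaseG.decoRealRR_rr_frozen_edge {ω : Config (ι ⊕ ↥RR)} {e : E} {r r' : V}
    (hr : r ∈ R) (hr' : r' ∈ R) (hrr : ends e = s(r, r')) (he : e ∉ RR) :
    decoRealRR ends A Z RR ζ ω e = false := by
  rw [DecoBaseE.decoRealRR_apply_of_notMem _ he]
  · exact hb.rr_blue e r r' hr hr' hrr he
  · rintro ⟨x, ⟨i, hx⟩, y, hxy⟩
    rw [hrr, Sym2.eq_iff] at hxy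
    rcases hxy with ⟨rfl, -⟩ | ⟨-, rfl⟩
    · exact hb.root_notMem_unit hr i hx
    · exact hb.root_notMem_unit hr' i hx

/-- An edge from a root to a frozen vertex is blue at every cube point. -/
lemma FrozenBaseG.decoRealRR_root_fz_edge {ω : Config (ι ⊕ ↥RR)} {e : E} {r z : V} (hr : r ∈ R)
    (hrz : ends e = s(r, z)) (hz : z ∈ Fz) : decoRealRR ends A Z RR ζ ω e = false := by
  rw [DecoBaseE.decoRealRR_apply_of_notMem]
  · exact hb.root_fz_blue e r z hr hrz hz
  · rintro ⟨x, ⟨i, hx⟩, y, hxy⟩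
    rw [hrz, Sym2.eq_iff] at hxy
    rcases hxy with ⟨rfl, -⟩ | ⟨-, rfl⟩
    · exact hb.root_notMem_unit hr i hx
    · exact hb.fz_notMem_unit hz i hx
  · exact hb.notMem_rr_of_notMem_R (ends_swap hrz) (hb.fz_notMem_root z hz)

/-- A vertex adjacent to a root is a root, lies in a movable arm, or is frozen. -/
lemma FrozenBaseG.root_edges' {e : E} {r x : V} (hr : r ∈ R) (hrx : ends e = s(r, x)) :
    x ∈ R ∨ (∃ i, x ∈ A i) ∨ x ∈ Fz :=
  hb.root_edges e r x hr hrx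

/-- **The realisation is injective.** -/
theorem FrozenBaseG.decoRealRR_injective : Function.Injective (decoRealRR ends A Z RR ζ) := by
  intro ω ω' heq
  funext i
  rcases i with i | ⟨e, he⟩
  · obtain ⟨x, hx⟩ := hb.arm_nonempty i
    obtain ⟨e, hxe⟩ := hb.arm_edge i x hx
    have hxy : ends e = s(x, Sym2.Mem.other hxe) := (Sym2.other_spec hxe).symm
    have h1 := hb.decoRealRR_apply_of_mem (ω := ω) hxy (Or.inl hx)
    have h2 := hb.decoRealRR_apply_of_mem (ω := ω') hxy (Or.inl hx)
    rw [heq] at h1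
    rw [h1] at h2
    by_contra hne
    have key : ∀ b b' : Bool, b ≠ b' →
        (if b = true then ζ e else !ζ e) ≠ (if b' = true then ζ e else !ζ e) := by
      intro b b' hbb'
      cases b <;> cases b' <;> simp at hbb' ⊢
    exact key _ _ hne h2
  · have h1 := hb.decoRealRR_rr_edge (ω := ω) he
    have h2 := hb.decoRealRR_rr_edge (ω := ω') he
    rw [heq] at h1
    by_contra hne
    cases hω : ω (Sum.inr ⟨e, he⟩) with
    | true =>
      have := h2.1 (h1.2 hω)
      rw [hω] at hne; exact hne this.symm
    | false =>
      have h3 : ω' (Sum.inr ⟨e, he⟩) ≠ true := fun h' => by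
        have := h1.1 (h2.2 h'); rw [hω] at this; simp at this
      have h3' : ω' (Sum.inr ⟨e, he⟩) = false := Bool.eq_false_iff.mpr h3
      rw [hω, h3'] at hne; exact hne rfl

end Base

/-! ## §2 The weak-cube hypotheses as theorems -/

section Mono

variable {ι : Type*} {A Z : ι → Set V} {ζ : Config E} {R H : Set V} {l : V} {RR : Finset E}
  {Fz : Set V} (hb : FrozenBaseG ends ζ R H l A Z RR Fz)
include hb

/-- **Red paths from a root visit roots and `true` movable arms only.** -/
lemma FrozenBaseG.red_closed (ω : Config (ι ⊕ ↥RR)) {x y : V}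
    (hx : x ∈ R ∪ armsTrueC A (armPart ω))
    (hxy : (openGraph ends (decoRealRR ends A Z RR ζ ω)).Adj x y) :
    y ∈ R ∪ armsTrueC A (armPart ω) := by
  obtain ⟨_, e, he, hxy⟩ := exists_edge_of_adj hxy
  rcases hx with hx | ⟨i, hi, hx⟩
  · rcases hb.root_edges e x y hx hxy with hy | ⟨j, hy⟩ | hy
    · exact Or.inl hy
    · have := (hb.decoRealRR_root_edge hx hxy hy).1 he
      exact Or.inr ⟨j, this, hy⟩
    · exfalso
      rw [hb.decoRealRR_root_fz_edge hx hxy hy] at he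
      exact absurd he (by decide)
  · by_cases hyR : y ∈ R
    · exact Or.inl hyR
    by_cases hyH : y ∈ H
    · have hyF : y ∉ Fz := hb.no_arm_fz e x y hxy ⟨i, hx⟩
      obtain ⟨j, hy⟩ := hb.arm_cover y hyH hyR hyF
      have hij : i = j := hb.unit_eq_of_edge hxy (Or.inl hx) (Or.inl hy)
      subst hij
      exact Or.inr ⟨i, hi, hy⟩
    · exfalso
      have := (hb.decoRealRR_out_edge hxy hx hyH).1 he
      simp only [armPart] at hi
      rw [hi] at this; exact absurd this (by decide)

/-- A vertex of the red cluster of a root at a cube point is a root or lies in a `true` movable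
arm. -/
theorem FrozenBaseG.mem_root_or_true_of_mem_cluster (ω : Config (ι ⊕ ↥RR)) {r x : V}
    (hr : r ∈ R) (hx : x ∈ cluster ends (decoRealRR ends A Z RR ζ ω) r) :
    x ∈ R ∨ ∃ i, armPart ω i = true ∧ x ∈ A i :=
  mem_of_conn_of_closed (S := R ∪ armsTrueC A (armPart ω))
    (fun _ hx' _ hxy => hb.red_closed ω hx' hxy) (Or.inl hr) hx

/-- The red cluster of a root at a cube point lies inside `H`. -/
theorem FrozenBaseG.cluster_subset_H (ω : Config (ι ⊕ ↥RR)) {r : V} (hr : r ∈ R) :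
    cluster ends (decoRealRR ends A Z RR ζ ω) r ⊆ H := by
  intro x hx
  rcases hb.mem_root_or_true_of_mem_cluster ω hr hx with h' | ⟨i, _, hi⟩
  · exact hb.root_sub h'
  · exact (hb.arm_sub i x hi).1

/-- The edges inside the red cluster of a root lie inside `R ∪ armsTrueC ω`. -/
lemma FrozenBaseG.within_cluster_subset {r : V} (hr : r ∈ R) (ω : Config (ι ⊕ ↥RR)) :
    within ends (cluster ends (decoRealRR ends A Z RR ζ ω) r) ⊆
      within ends (R ∪ armsTrueC A (armPart ω)) :=
  within_mono (fun x hx => by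
    rcases hb.mem_root_or_true_of_mem_cluster ω hr hx with h' | ⟨i, hi, hx'⟩
    · exact Or.inl h'
    · exact Or.inr ⟨i, hi, hx'⟩)

/-- A vertex of `R ∪ armsTrueC ω` that lies in a unit has its unit `true`. -/
lemma FrozenBaseG.unit_of_mem_true {ω : Config ι} {z : V} {i : ι}
    (hz : z ∈ R ∪ armsTrueC A ω) (hzi : z ∈ unitAZ A Z i) : ω i = true := by
  rcases hz with hz | ⟨j, hj, hz⟩
  · exact absurd hzi (hb.root_notMem_unit hz i)
  · rcases hzi with hzi | hzi
    · have hji : j = i := by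
        by_contra hne
        exact hb.arm_disj j i hne z hz hzi
      rw [← hji]; exact hj
    · exact absurd hz (hb.deco_notMem_arm hzi)

/-- Two cube points agreeing on the unit of an end of an edge (and on the edge, if it joins two
roots) colour that edge alike. -/
lemma FrozenBaseG.decoRealRR_eq_of_agree {ω ω' : Config (ι ⊕ ↥RR)} {e : E}
    (hag : ∀ i, (∃ x ∈ unitAZ A Z i, x ∈ ends e) → ω (Sum.inl i) = ω' (Sum.inl i))
    (hrr : ∀ he : e ∈ RR, ω (Sum.inr ⟨e, he⟩) = ω' (Sum.inr ⟨e, he⟩)) :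
    decoRealRR ends A Z RR ζ ω e = decoRealRR ends A Z RR ζ ω' e := by
  by_cases he : e ∈ RR
  · rw [decoRealRR_apply_rr he, decoRealRR_apply_rr he, hrr he]
  by_cases ht : e ∈ touches ends (allArms (unitAZ A Z))
  · obtain ⟨i, x, y, hxy, hx⟩ := DecoBaseE.exists_unit_of_touches ht
    rw [hb.decoRealRR_apply_of_mem hxy hx, hb.decoRealRR_apply_of_mem hxy hx,
      hag i ⟨x, hx, by rw [hxy]; exact Sym2.mem_mk_left x y⟩]
  · rw [DecoBaseE.decoRealRR_apply_of_notMem ht he, DecoBaseE.decoRealRR_apply_of_notMem ht he]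

/-- A red edge inside `R ∪ armsTrueC ω` is red at every `ω' ≥ ω`. -/
lemma FrozenBaseG.decoRealRR_le_of_within_true {ω ω' : Config (ι ⊕ ↥RR)} (hω : ω ≤ ω') {e : E}
    (he : e ∈ within ends (R ∪ armsTrueC A (armPart ω)))
    (hred : decoRealRR ends A Z RR ζ ω e = true) : decoRealRR ends A Z RR ζ ω' e = true := by
  by_cases hrr : e ∈ RR
  · rw [hb.decoRealRR_rr_edge hrr] at hred ⊢
    have := hω (Sum.inr ⟨e, hrr⟩); rw [hred] at this; exact Bool.eq_true_of_true_le this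
  · rw [← hred]
    refine (hb.decoRealRR_eq_of_agree (fun i ⟨x, hx, hxe⟩ => ?_) (fun h' => absurd h' hrr)).symm
    obtain ⟨a, ha, b, hb', hab⟩ := he
    rw [hab, Sym2.mem_iff] at hxe
    have hi : armPart ω i = true := by
      rcases hxe with rfl | rfl
      · exact hb.unit_of_mem_true ha hx
      · exact hb.unit_of_mem_true hb' hx
    have hi' : ω' (Sum.inl i) = true := by
      have := hω (Sum.inl i); simp only [armPart] at hi; rw [hi] at this
      exact Bool.eq_true_of_true_le this
    simp only [armPart] at hi
    rw [hi, hi']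

/-- **The red cluster of a root is increasing in the cube point.** -/
theorem FrozenBaseG.cluster_decoRealRR_mono {r : V} (hr : r ∈ R) {ω ω' : Config (ι ⊕ ↥RR)}
    (hω : ω ≤ ω') :
    cluster ends (decoRealRR ends A Z RR ζ ω) r ⊆ cluster ends (decoRealRR ends A Z RR ζ ω') r :=
  cluster_subset_of_le_within (S := R ∪ armsTrueC A (armPart ω))
    (fun _ hx _ hxy => hb.red_closed ω hx hxy) (Or.inl hr)
    (fun _ he hred => hb.decoRealRR_le_of_within_true hω he hred)

/-- **The red edge set of `h` is increasing in the cube point.** -/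
theorem FrozenBaseG.redEdges_decoRealRR_mono {h : V} (hh : h ∈ R) {ω ω' : Config (ι ⊕ ↥RR)}
    (hω : ω ≤ ω') :
    redEdges ends (decoRealRR ends A Z RR ζ ω) h ⊆
      redEdges ends (decoRealRR ends A Z RR ζ ω') h := by
  rintro e ⟨he, hw⟩
  exact ⟨hb.decoRealRR_le_of_within_true hω (hb.within_cluster_subset hh ω hw) he,
    within_mono (hb.cluster_decoRealRR_mono hh hω) hw⟩


end Mono

end LocRows

end Summit.Ventures.PercRepro2
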